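import Summits.ResolutionOfSingularities.ResolutionOfSingularities.Theorems.FrobeniusClosingPatchingRelPerfectCuspLineStepGlue
import Literature.AlgebraicGeometry.Resolution.BlowupChartRsop
import HarnessLib

/-!
# Crux `PatchingRelPerfect` (stmt-ResolutionOfSingularities-16161), chain W5.2 — F7(β) (β-AX) PHASE C,
# chart certificate C1: ONE blow-up disposes of a DETACHED CYLINDER (every contact order)

[OURS · L1 W5.2 · F7(β) (β-AX) Phase C · res-L1-w52-plan-1 RULING G10-7 (c) / `F7BETA-PHASEC-HANDCHECKS.md` §C1
(1544a43f30237cd8)] res-L1-w52-stub-1 g5.  Replaces the role of NO printed item; NOT a statement of the manuscript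
under review (AI-written, weaker than expert review).  A MACHINE CHECK of the planner's hand chart computation, at
ring level over an ARBITRARY commutative ring, for EVERY contact order.

Frame (the memo's letters; `n = k − 1 ≥ 1` is the contact order minus one).  After the `inCons` move at the foot of a
charged cylinder the residual ideal near the detached cylinder is

  `K′ = (h) + (tⁿ xⁿ⁺¹ − y) + (t² y)`

with members `H = V(h)`, `𝓐₂′ = V(tⁿ xⁿ⁺¹ − y)`, the old exceptional `V(t)` (exponent `2`) and `F̃ = V(y)` (exponent `1`);
the detached cylinder is the `t`-axis `W̃ = V(h, y, x)`.  This file proves: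

* `K_le_centre` — `K′ ≤ (h, y, x)` (the move is legal with weight `ν = 1`);
* §1 the pure chart algebra of `Bl_{(h, y, x)}` under the three substitutions (any commutative ring): on the
  `x`-chart (`h = g h₁`, `y = g y₁`, `x = g`) `K′ = (g) · K″` with
  **`K″ = (h₁) + (𝓐₂″) + (tⁿ⁺² gⁿ)`, `𝓐₂″ := tⁿ gⁿ − y₁`** (`xChart_K`, `xChart_residual_eq`, `xChart_K_eq`) — a
  MONOMIAL SUM in the four letters `h₁, 𝓐₂″, t, g`, which differ from the chart letters `h₁, y₁, t, g` by the
  unimodular exchange `y₁ = tⁿ gⁿ − 𝓐₂″`, `tⁿ gⁿ ∈ (t)·(g)` (`residualHost_add_mem`); on the `h`-chart `K′ = (g)`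
  (`hChart_K`) and on the `y`-chart `K′ = (g)` as soon as `n ≥ 1` (`yChart_K`: `t` is a unit modulo
  `tⁿ gⁿ x′ⁿ⁺¹ − 1`, so `(…, t²) = ⊤`);
* §2 the same identities for the IMAGES of `K′` under the three Rees chart maps `chartBase ![h, y, x] i`
  (`map_K_two`, `map_K_zero`, `map_K_one`): the controlled transform (`ν = 1`) is `K″` on the `x`-chart and the
  unit ideal on the other two charts — «END after ONE X-only move, every k» of RULING G10-7 (c);
* §3 the END is an snc presentation: for `R` regular local with regular system of parameters `(h, y, x, t, w…)`, at
  every prime `𝔓` of the `x`-chart over `𝔪_R` containing `h₁, y₁`, the exchanged family `(x, h₁, 𝓐₂″, t, w…)` is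
  PART OF A REGULAR SYSTEM OF PARAMETERS of `B_𝔓` (`isRsopPart_xChart_exchanged`, from `isRsopPart_chartFamily_reesChart`
  and `IsRsopPart.of_span_range_eq`), and `K′ B_𝔓 = (x) · ((h₁) + (𝓐₂″) + (tⁿ⁺² xⁿ))` (`map_K_two_local`); primes
  missing `h₁` or `y₁` carry the unit ideal (`residualAfter_eq_top_of_isUnit_left`, `residualAfter_eq_top_of_isUnit_y`).

Fact-free; FORMAT / design evidence for the (β-AX) variant (CHAIN v2.9 lead (iii)).  What it does NOT say: anything
about the E-side, about poles (C2/C3), or about second-generation limit points (Q10).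

## References
* The Stacks Project, Tags 0804, 0BIQ (affine blow-up algebras and their charts). [StacksProject]
* A. J. de Jong, *Smoothness, semi-stability and alterations*, Publ. Math. IHÉS 83 (1996), 2.4. [DeJong1996]
* U. Görtz, T. Wedhorn, *Algebraic Geometry I*, 2nd ed. (2020), (13.19) p. 415. [GortzWedhorn2020]
* J. Kollár, *Lectures on Resolution of Singularities* (2007), (3.111) Step 3 (monomial bookkeeping). [Kollar2007]
-/

-- `Summit.<Summit>.<Sub>.Theorems` with `Sub = Summit` (single-conjunct summit, D-0017)
set_option linter.dupNamespace false

noncomputable section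

open IsLocalRing Literature.AlgebraicGeometry.Resolution

namespace Summit.ResolutionOfSingularities.ResolutionOfSingularities.Theorems

universe u

namespace DepthPhaseC

/-- The residual `K′ = (h) + (tⁿ xⁿ⁺¹ − y) + (t² y)` near the detached cylinder `V(h, y, x)`. -/
local notation3 "Kres[" h "," y "," x "," t "," n "]" =>
  (Ideal.span {h} ⊔ Ideal.span {t ^ n * x ^ (n + 1) - y} ⊔ Ideal.span {t ^ 2 * y})
/-- The host after the move, `𝓐₂″ = tⁿ gⁿ − y₁`. -/
local notation3 "Host[" y₁ "," g "," t "," n "]" => (t ^ n * g ^ n - y₁)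
/-- The controlled transform on the `x`-chart, `K″ = (h₁) + (𝓐₂″) + (tⁿ⁺² gⁿ)`. -/
local notation3 "Kaft[" h₁ "," y₁ "," g "," t "," n "]" =>
  (Ideal.span {h₁} ⊔ Ideal.span {t ^ n * g ^ n - y₁} ⊔ Ideal.span {t ^ (n + 2) * g ^ n})

/-! ## §0 Glue -/

section Glue

variable {A : Type u} [CommRing A]

/-- `J + (a) = J + (b)` if `a ≡ b (mod J)`. [folklore] -/
theorem sup_span_singleton_congr {J : Ideal A} {a b : A} (h : a - b ∈ J) :
    J ⊔ Ideal.span {a} = J ⊔ Ideal.span {b} := by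
  refine le_antisymm (sup_le le_sup_left ?_) (sup_le le_sup_left ?_) <;> rw [Ideal.span_singleton_le_iff_mem]
  · rw [show a = (a - b) + b by ring]
    exact Ideal.add_mem _ (Ideal.mem_sup_left h) (Ideal.mem_sup_right (Ideal.mem_span_singleton_self b))
  · rw [show b = a - (a - b) by ring]
    exact Ideal.sub_mem _ (Ideal.mem_sup_right (Ideal.mem_span_singleton_self a)) (Ideal.mem_sup_left h)

/-- `(g) · ((a) + (b) + (c)) = (g a) + (g b) + (g c)`. [folklore] -/
theorem span_singleton_mul_sup₃ (g a b c : A) :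
    Ideal.span {g} * (Ideal.span {a} ⊔ Ideal.span {b} ⊔ Ideal.span {c}) =
      Ideal.span {g * a} ⊔ Ideal.span {g * b} ⊔ Ideal.span {g * c} := by
  rw [Ideal.mul_sup, Ideal.mul_sup, Ideal.span_singleton_mul_span_singleton,
    Ideal.span_singleton_mul_span_singleton, Ideal.span_singleton_mul_span_singleton]

/-- `(a) + (b) = ⊤` when `u a + v b = 1`. [folklore] -/
theorem span_sup_span_eq_top_of_eq {a b u v : A} (h : u * a + v * b = 1) :
    Ideal.span {a} ⊔ Ideal.span {b} = ⊤ := by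
  rw [Ideal.eq_top_iff_one, ← h]
  exact Ideal.add_mem _ (Ideal.mem_sup_left (Ideal.mul_mem_left _ _ (Ideal.mem_span_singleton_self a)))
    (Ideal.mem_sup_right (Ideal.mul_mem_left _ _ (Ideal.mem_span_singleton_self b)))

/-- `Ideal.map` of a three-term sup of principal ideals. [folklore] -/
theorem map_sup₃ {B : Type*} [CommRing B] (f : A →+* B) (a b c : A) :
    (Ideal.span {a} ⊔ Ideal.span {b} ⊔ Ideal.span {c}).map f =
      Ideal.span {f a} ⊔ Ideal.span {f b} ⊔ Ideal.span {f c} := by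
  rw [Ideal.map_sup, Ideal.map_sup, CuspMember.map_span_singleton, CuspMember.map_span_singleton,
    CuspMember.map_span_singleton]

/-- **Parts of regular systems of parameters only depend on the ideal they generate** (same length).
[cite: Matsumura1987, Thm. 14.2] -/
theorem _root_.Literature.AlgebraicGeometry.Resolution.IsRsopPart.of_span_range_eq [IsLocalRing A] {m : ℕ}
    {z z' : Fin m → A} (hz : IsRsopPart z) (h : Ideal.span (Set.range z') = Ideal.span (Set.range z)) :
    IsRsopPart z' := by
  obtain ⟨hR, e, w, hdim, hspan⟩ := hz
  exact ⟨hR, e, w, hdim, by rw [Ideal.span_union] at hspan ⊢; rw [h]; exact hspan⟩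

end Glue

/-! ## §1 The residual, the centre, and the algebra of the three charts -/

section Algebra

variable {A : Type u} [CommRing A]

/-- **Legality (`ν = 1`)**: `K′ ≤ (h, y, x)`. [folklore] -/
theorem K_le_centre (h y x t : A) (n : ℕ) : Kres[h, y, x, t, n] ≤ Ideal.span (Set.range ![h, y, x]) := by
  rw [CuspMember.span_range_vec3]
  refine sup_le (sup_le (le_sup_of_le_left le_sup_left) ?_) ?_
  · rw [Ideal.span_singleton_le_iff_mem]
    have e : t ^ n * x ^ (n + 1) - y = (t ^ n * x ^ n) * x - y := by ring
    rw [e]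
    exact Ideal.sub_mem _ (Ideal.mem_sup_right (Ideal.mul_mem_left _ _ (Ideal.mem_span_singleton_self x)))
      (Ideal.mem_sup_left (Ideal.mem_sup_right (Ideal.mem_span_singleton_self y)))
  · rw [Ideal.span_singleton_le_iff_mem]
    exact Ideal.mem_sup_left (Ideal.mem_sup_right (Ideal.mul_mem_left _ _ (Ideal.mem_span_singleton_self y)))

/-- **The exchange relation**: `𝓐₂″ + y₁ = tⁿ gⁿ ∈ (t)·(g)` for `n ≥ 1`. [folklore] -/
theorem residualHost_add_mem (y₁ g t : A) {n : ℕ} (hn : 1 ≤ n) :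
    Host[y₁, g, t, n] + y₁ ∈ Ideal.span {t} * Ideal.span {g} := by
  rw [sub_add_cancel, Ideal.span_singleton_mul_span_singleton]
  obtain ⟨m, rfl⟩ := Nat.exists_eq_add_of_le hn
  exact Ideal.mem_span_singleton.mpr ⟨t ^ m * g ^ m, by ring⟩

/-- `(g) + (𝓐₂″) = (g) + (y₁)` for `n ≥ 1`. [folklore] -/
theorem span_g_sup_residualHost (y₁ g t : A) {n : ℕ} (hn : 1 ≤ n) :
    Ideal.span {g} ⊔ Ideal.span {Host[y₁, g, t, n]} = Ideal.span {g} ⊔ Ideal.span {y₁} := by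
  rw [← Ideal.span_singleton_neg y₁]
  refine sup_span_singleton_congr ?_
  rw [sub_neg_eq_add]
  exact Ideal.mul_le_left (residualHost_add_mem y₁ g t hn)

/-- **`x`-chart** (`h = g h₁`, `y = g y₁`, `x = g`): `K′ = (g) · ((h₁) + (tⁿ gⁿ − y₁) + (t² y₁))`. [folklore] -/
theorem xChart_K (h₁ y₁ g t : A) (n : ℕ) :
    Kres[g * h₁, g * y₁, g, t, n] =
      Ideal.span {g} * (Ideal.span {h₁} ⊔ Ideal.span {t ^ n * g ^ n - y₁} ⊔ Ideal.span {t ^ 2 * y₁}) := by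
  rw [span_singleton_mul_sup₃, show t ^ n * g ^ (n + 1) - g * y₁ = g * (t ^ n * g ^ n - y₁) by ring,
    show t ^ 2 * (g * y₁) = g * (t ^ 2 * y₁) by ring]

/-- **The controlled transform is a monomial sum**: `(h₁) + (𝓐₂″) + (t² y₁) = (h₁) + (𝓐₂″) + (tⁿ⁺² gⁿ)`, because
`t² y₁ = tⁿ⁺² gⁿ − t² 𝓐₂″`. [cite: Kollar2007, (3.111) Step 3] -/
theorem xChart_residual_eq (h₁ y₁ g t : A) (n : ℕ) :
    Ideal.span {h₁} ⊔ Ideal.span {t ^ n * g ^ n - y₁} ⊔ Ideal.span {t ^ 2 * y₁} = Kaft[h₁, y₁, g, t, n] := by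
  refine sup_span_singleton_congr ?_
  have e : t ^ 2 * y₁ - t ^ (n + 2) * g ^ n = (-t ^ 2) * (t ^ n * g ^ n - y₁) := by ring
  rw [e]
  exact Ideal.mem_sup_right (Ideal.mul_mem_left _ _ (Ideal.mem_span_singleton_self _))

/-- **`x`-chart, assembled**: `K′ = (g) · K″`. [folklore] -/
theorem xChart_K_eq (h₁ y₁ g t : A) (n : ℕ) :
    Kres[g * h₁, g * y₁, g, t, n] = Ideal.span {g} * Kaft[h₁, y₁, g, t, n] := by
  rw [xChart_K, xChart_residual_eq]

/-- **`h`-chart** (`h = g`, `y = g y′`, `x = g x′`): `K′ = (g)` (the host `H` swallows the chart). [folklore] -/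
theorem hChart_K (y' x' g t : A) (n : ℕ) : Kres[g, g * y', g * x', t, n] = Ideal.span {g} := by
  apply le_antisymm
  · refine sup_le (sup_le le_rfl ?_) ?_
    · rw [Ideal.span_singleton_le_iff_mem]
      exact Ideal.mem_span_singleton.mpr ⟨t ^ n * g ^ n * x' ^ (n + 1) - y', by ring⟩
    · rw [Ideal.span_singleton_le_iff_mem]
      exact Ideal.mem_span_singleton.mpr ⟨t ^ 2 * y', by ring⟩
  · exact le_sup_of_le_left le_sup_left

/-- **`y`-chart** (`y = g`, `h = g h′`, `x = g x′`), `n ≥ 1`: `K′ = (g)`, because `t` is a unit modulo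
`tⁿ gⁿ x′ⁿ⁺¹ − 1` and `t²` is a generator. [folklore] -/
theorem yChart_K (h' x' g t : A) {n : ℕ} (hn : 1 ≤ n) : Kres[g * h', g, g * x', t, n] = Ideal.span {g} := by
  obtain ⟨m, rfl⟩ := Nat.exists_eq_add_of_le hn
  -- the cofactor ideal is the unit ideal
  have htop : Ideal.span {t ^ (1 + m) * g ^ (1 + m) * x' ^ (1 + m + 1) - 1} ⊔ Ideal.span {t ^ 2} = ⊤ := by
    refine span_sup_span_eq_top_of_eq (u := -(t ^ (1 + m) * g ^ (1 + m) * x' ^ (1 + m + 1) + 1))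
      (v := (t ^ m * g ^ (1 + m) * x' ^ (1 + m + 1)) ^ 2) ?_
    ring
  apply le_antisymm
  · refine sup_le (sup_le ?_ ?_) ?_
    · rw [Ideal.span_singleton_le_iff_mem]
      exact Ideal.mem_span_singleton.mpr ⟨h', rfl⟩
    · rw [Ideal.span_singleton_le_iff_mem]
      exact Ideal.mem_span_singleton.mpr ⟨t ^ (1 + m) * g ^ (1 + m) * x' ^ (1 + m + 1) - 1, by ring⟩
    · rw [Ideal.span_singleton_le_iff_mem]
      exact Ideal.mem_span_singleton.mpr ⟨t ^ 2, by ring⟩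
  · have e : Ideal.span {g} = Ideal.span {g} *
        (Ideal.span {t ^ (1 + m) * g ^ (1 + m) * x' ^ (1 + m + 1) - 1} ⊔ Ideal.span {t ^ 2}) := by
      rw [htop, Ideal.mul_top]
    rw [e, Ideal.mul_sup, Ideal.span_singleton_mul_span_singleton, Ideal.span_singleton_mul_span_singleton]
    refine sup_le ?_ ?_
    · refine le_sup_of_le_left (le_sup_of_le_right (le_of_eq ?_))
      congr 2
      ring
    · refine le_sup_of_le_right (le_of_eq ?_)
      congr 2
      ring

/-- Off the host `H″ = V(h₁)` the controlled transform is the unit ideal. [folklore] -/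
theorem residualAfter_eq_top_of_isUnit_left {h₁ : A} (hu : IsUnit h₁) (y₁ g t : A) (n : ℕ) :
    Kaft[h₁, y₁, g, t, n] = ⊤ := by
  rw [Ideal.span_singleton_eq_top.mpr hu, top_sup_eq, top_sup_eq]

/-- Off `V(y₁)` the controlled transform is the unit ideal: in a local ring, if `y₁` is a unit and `g ∈ 𝔪` then
`𝓐₂″ = tⁿ gⁿ − y₁` is a unit (`n ≥ 1`). [folklore] -/
theorem residualAfter_eq_top_of_isUnit_y [IsLocalRing A] {y₁ g : A} (hu : IsUnit y₁) (hg : g ∈ maximalIdeal A)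
    (h₁ t : A) {n : ℕ} (hn : 1 ≤ n) : Kaft[h₁, y₁, g, t, n] = ⊤ := by
  have hunit : IsUnit (t ^ n * g ^ n - y₁) := by
    by_contra hnu
    have hmem : t ^ n * g ^ n - y₁ ∈ maximalIdeal A := (IsLocalRing.mem_maximalIdeal _).mpr hnu
    have hm : t ^ n * g ^ n ∈ maximalIdeal A :=
      Ideal.mul_mem_left _ _ (Ideal.pow_mem_of_mem (maximalIdeal A) hg n hn)
    have hy : y₁ ∈ maximalIdeal A := by
      have e : y₁ = t ^ n * g ^ n - (t ^ n * g ^ n - y₁) := by ring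
      rw [e]
      exact Ideal.sub_mem _ hm hmem
    exact (IsLocalRing.mem_maximalIdeal _).mp hy hu
  rw [Ideal.span_singleton_eq_top.mpr hunit, sup_top_eq, top_sup_eq]

/-- Off the old exceptional `V(t)` the controlled transform is `(h₁) + (y₁) + (gⁿ)` — again a monomial sum in chart
letters. [folklore] -/
theorem residualAfter_eq_of_isUnit_t {t : A} (hu : IsUnit t) (h₁ y₁ g : A) (n : ℕ) :
    Kaft[h₁, y₁, g, t, n] = Ideal.span {h₁} ⊔ Ideal.span {y₁} ⊔ Ideal.span {g ^ n} := by
  obtain ⟨u, rfl⟩ := hu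
  have e3 : Ideal.span {(u : A) ^ (n + 2) * g ^ n} = Ideal.span {g ^ n} := by
    rw [Ideal.span_singleton_mul_left_unit (u.isUnit.pow (n + 2))]
  rw [e3, sup_right_comm _ (Ideal.span {(u : A) ^ n * g ^ n - y₁}), sup_right_comm _ (Ideal.span {y₁})]
  rw [← Ideal.span_singleton_neg y₁]
  refine sup_span_singleton_congr ?_
  rw [sub_neg_eq_add, sub_add_cancel]
  exact Ideal.mem_sup_right (Ideal.mem_span_singleton.mpr ⟨(u : A) ^ n, by ring⟩)

end Algebra

/-! ## §2 The images on the three Rees charts of `Bl_{(h, y, x)}` -/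

section Charts

variable {R : Type u} [CommRing R] (h y x t : R)

local notation3 "cc" => (![h, y, x] : Fin 3 → R)

set_option maxHeartbeats 400000 in
-- instance-path defeq through `HomogeneousLocalization`'s standalone `Pow`/`Mul` (as in p508825)
/-- **`x`-chart image**: `K′ · B_x = (x) · K″(h/x, y/x, x, t)` — the controlled transform (`ν = 1`) of the residual
along the detached cylinder is the monomial sum `K″`. [cite: StacksProject, Tag 0804] -/
theorem map_K_two (n : ℕ) :
    (Kres[h, y, x, t, n]).map (chartBase cc 2) =
      Ideal.span {chartBase cc 2 x} *
        Kaft[chartGen cc 2 0, chartGen cc 2 1, chartBase cc 2 x, chartBase cc 2 t, n] := by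
  have cb_h : chartBase cc 2 h = chartBase cc 2 x * chartGen cc 2 0 := reesChartBase_apply_eq_mul_chartGen cc 2 0
  have cb_y : chartBase cc 2 y = chartBase cc 2 x * chartGen cc 2 1 := reesChartBase_apply_eq_mul_chartGen cc 2 1
  rw [map_sup₃, map_sub, map_mul, map_mul, map_pow, map_pow, map_pow, cb_h, cb_y]
  exact xChart_K_eq _ _ _ _ n

set_option maxHeartbeats 400000 in
-- instance-path defeq through `HomogeneousLocalization`'s standalone `Pow`/`Mul` (as in p508825)
/-- **`h`-chart image**: `K′ · B_h = (h)` — the controlled transform is the unit ideal. [cite: StacksProject, Tag 0804] -/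
theorem map_K_zero (n : ℕ) : (Kres[h, y, x, t, n]).map (chartBase cc 0) = Ideal.span {chartBase cc 0 h} := by
  have cb_y : chartBase cc 0 y = chartBase cc 0 h * chartGen cc 0 1 := reesChartBase_apply_eq_mul_chartGen cc 0 1
  have cb_x : chartBase cc 0 x = chartBase cc 0 h * chartGen cc 0 2 := reesChartBase_apply_eq_mul_chartGen cc 0 2
  rw [map_sup₃, map_sub, map_mul, map_mul, map_pow, map_pow, map_pow, cb_y, cb_x]
  exact hChart_K _ _ _ _ n

set_option maxHeartbeats 400000 in
-- instance-path defeq through `HomogeneousLocalization`'s standalone `Pow`/`Mul` (as in p508825)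
/-- **`y`-chart image** (`n ≥ 1`): `K′ · B_y = (y)` — the controlled transform is the unit ideal.
[cite: StacksProject, Tag 0804] -/
theorem map_K_one {n : ℕ} (hn : 1 ≤ n) : (Kres[h, y, x, t, n]).map (chartBase cc 1) = Ideal.span {chartBase cc 1 y} := by
  have cb_h : chartBase cc 1 h = chartBase cc 1 y * chartGen cc 1 0 := reesChartBase_apply_eq_mul_chartGen cc 1 0
  have cb_x : chartBase cc 1 x = chartBase cc 1 y * chartGen cc 1 2 := reesChartBase_apply_eq_mul_chartGen cc 1 2
  rw [map_sup₃, map_sub, map_mul, map_mul, map_pow, map_pow, map_pow, cb_h, cb_x]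
  exact yChart_K _ _ _ _ hn

end Charts

/-! ## §3 END at the local rings of the `x`-chart over the closed point -/

section Local

variable {R : Type u} [CommRing R] [IsRegularLocalRing R] (h y x t : R) {l : ℕ} (w : Fin l → R)
  (hz : Ideal.span (Set.range (Fin.append ![h, y, x] (Fin.cons t w : Fin (l + 1) → R))) = maximalIdeal R)
  (hd : (maximalIdeal R).spanFinrank = 3 + (l + 1))

variable (𝔓 : Ideal (chartRing (![h, y, x] : Fin 3 → R) 2)) [𝔓.IsPrime]
  (h𝔓 : 𝔓.comap (chartBase (![h, y, x] : Fin 3 → R) 2) = maximalIdeal R)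
  (L : Type u) [CommRing L] [IsLocalRing L] [Algebra (chartRing (![h, y, x] : Fin 3 → R) 2) L]
  [IsLocalization.AtPrime L 𝔓]

local notation3 "cc" => (![h, y, x] : Fin 3 → R)
local notation3 "tw" => (Fin.cons t w : Fin (l + 1) → R)
-- the localisation map `B → L = B_𝔓`, type-ascribed (the bare `algebraMap B L b` leaves the instance path stuck)
local notation3 "φL" => (algebraMap (chartRing (![h, y, x] : Fin 3 → R) 2) L :
  chartRing (![h, y, x] : Fin 3 → R) 2 →+* L)

omit [IsRegularLocalRing R] [𝔓.IsPrime] [IsLocalRing L] [IsLocalization.AtPrime L 𝔓] in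
/-- `range (Fin.append u v) = range u ∪ range v`. [folklore] -/
private theorem range_fin_append {α : Type*} {m k : ℕ} (u : Fin m → α) (v : Fin k → α) :
    Set.range (Fin.append u v) = Set.range u ∪ Set.range v := by
  ext a
  constructor
  · rintro ⟨i, rfl⟩
    induction i using Fin.addCases with
    | left j => exact Or.inl ⟨j, by simp⟩
    | right j => exact Or.inr ⟨j, by simp⟩
  · rintro (⟨j, rfl⟩ | ⟨j, rfl⟩)
    · exact ⟨Fin.castAdd k j, by simp⟩
    · exact ⟨Fin.natAdd m j, by simp⟩

/-- The enumeration `(h/x, y/x)` of the two chart generators other than `x/x`. -/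
local notation3 "jJ" => (![⟨0, by decide⟩, ⟨1, by decide⟩] : Fin 2 → {j : Fin 3 // j ≠ 2})

omit [IsRegularLocalRing R] [𝔓.IsPrime] [IsLocalRing L] [IsLocalization.AtPrime L 𝔓] in
/-- The chart family `(x, h/x, y/x, t, w…)` of `…BlowupChartRsop`, unfolded. [folklore] -/
theorem chartFamily_eq :
    chartFamily cc 2 tw L (chartBase cc 2) (chartGen cc 2) jJ =
      Fin.cons (φL (chartBase cc 2 x)) (Fin.append ![φL (chartGen cc 2 0), φL (chartGen cc 2 1)]
        fun k => φL (chartBase cc 2 (tw k))) := by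
  have hf : (fun k : Fin 2 => φL (chartGen cc 2 (jJ k).1)) = ![φL (chartGen cc 2 0), φL (chartGen cc 2 1)] := by
    funext k
    fin_cases k <;> rfl
  unfold chartFamily
  rw [← hf]
  rfl

include hz hd h𝔓 in
/-- [OURS · L1 W5.2 · (β-AX) Phase C · C1] **END is an snc presentation.** `R` regular local with regular system of
parameters `(h, y, x, t, w…)`; at a prime `𝔓` of the `x`-chart of `Bl_{(h,y,x)} Spec R` over `𝔪_R` that contains
`h/x` and `y/x`, the EXCHANGED family `(x, h/x, 𝓐₂″, t, w…)`, `𝓐₂″ = tⁿ xⁿ − y/x` (`n ≥ 1`), is part of a regular system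
of parameters of the local ring `L = B_𝔓`.  [cite: DeJong1996, 2.4] [cite: StacksProject, Tag 0BIQ] -/
theorem isRsopPart_xChart_exchanged (h0 : chartGen cc 2 0 ∈ 𝔓) (h1 : chartGen cc 2 1 ∈ 𝔓) {n : ℕ} (hn : 1 ≤ n) :
    IsRsopPart (Fin.cons (φL (chartBase cc 2 x))
      (Fin.append ![φL (chartGen cc 2 0),
          φL (Host[chartGen cc 2 1, chartBase cc 2 x, chartBase cc 2 t, n])]
        fun k => φL (chartBase cc 2 (tw k))) : Fin (2 + (l + 1) + 1) → L) := by
  have hrsop := isRsopPart_chartFamily_reesChart cc 2 tw hz hd 𝔓 h𝔓 L jJ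
    (fun a b hab => by fin_cases a <;> fin_cases b <;> simp_all) (fun k => by fin_cases k <;> assumption)
  rw [chartFamily_eq] at hrsop
  refine hrsop.of_span_range_eq ?_
  simp only [Fin.range_cons, range_fin_append, Matrix.range_cons, Matrix.range_empty, Set.union_empty,
    Set.singleton_union, Ideal.span_insert, Ideal.span_union]
  -- `(x) + ((h₁) + (𝓐₂″)) + rest = (x) + ((h₁) + (y₁)) + rest`
  have key : Ideal.span {φL (chartBase cc 2 x)} ⊔
      Ideal.span {φL (Host[chartGen cc 2 1, chartBase cc 2 x, chartBase cc 2 t, n])} =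
        Ideal.span {φL (chartBase cc 2 x)} ⊔ Ideal.span {φL (chartGen cc 2 1)} := by
    -- push `φL` through `𝓐₂″` (explicit `RingHom.map_*` terms: the chart ring's standalone `Sub/Mul/Pow` instances
    -- defeat `rw [map_sub]`)
    have e1 : φL (Host[chartGen cc 2 1, chartBase cc 2 x, chartBase cc 2 t, n]) =
        φL (chartBase cc 2 t ^ n * chartBase cc 2 x ^ n) - φL (chartGen cc 2 1) :=
      map_sub φL (chartBase cc 2 t ^ n * chartBase cc 2 x ^ n) (chartGen cc 2 1)
    have e2 : φL (chartBase cc 2 t ^ n * chartBase cc 2 x ^ n) = φL (chartBase cc 2 t ^ n) * φL (chartBase cc 2 x ^ n) :=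
      map_mul φL (chartBase cc 2 t ^ n) (chartBase cc 2 x ^ n)
    have e3 : φL (chartBase cc 2 t ^ n) = φL (chartBase cc 2 t) ^ n := map_pow φL (chartBase cc 2 t) n
    have e4 : φL (chartBase cc 2 x ^ n) = φL (chartBase cc 2 x) ^ n := map_pow φL (chartBase cc 2 x) n
    rw [e1, e2, e3, e4]
    exact span_g_sup_residualHost _ _ _ hn
  rw [← sup_assoc, ← sup_assoc, ← sup_assoc, ← sup_assoc, sup_right_comm (Ideal.span {φL (chartBase cc 2 x)}),
    key, ← sup_right_comm (Ideal.span {φL (chartBase cc 2 x)})]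

omit [IsRegularLocalRing R] [𝔓.IsPrime] [IsLocalRing L] [IsLocalization.AtPrime L 𝔓] in
/-- **The residual in `L`**: `K′ L = (x) · ((h/x) + (𝓐₂″) + (tⁿ⁺² xⁿ))` — a monomial sum in the exchanged family.
[cite: StacksProject, Tag 0804] -/
theorem map_K_two_local (n : ℕ) :
    (Kres[h, y, x, t, n]).map (RingHom.comp φL (chartBase cc 2)) =
      Ideal.span {φL (chartBase cc 2 x)} *
        Kaft[φL (chartGen cc 2 0), φL (chartGen cc 2 1), φL (chartBase cc 2 x), φL (chartBase cc 2 t), n] := by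
  have e1 : φL (Host[chartGen cc 2 1, chartBase cc 2 x, chartBase cc 2 t, n]) =
      φL (chartBase cc 2 t ^ n * chartBase cc 2 x ^ n) - φL (chartGen cc 2 1) :=
    map_sub φL (chartBase cc 2 t ^ n * chartBase cc 2 x ^ n) (chartGen cc 2 1)
  have e2 : φL (chartBase cc 2 t ^ n * chartBase cc 2 x ^ n) = φL (chartBase cc 2 t ^ n) * φL (chartBase cc 2 x ^ n) :=
    map_mul φL (chartBase cc 2 t ^ n) (chartBase cc 2 x ^ n)
  have e3 : φL (chartBase cc 2 t ^ n) = φL (chartBase cc 2 t) ^ n := map_pow φL (chartBase cc 2 t) n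
  have e4 : φL (chartBase cc 2 x ^ n) = φL (chartBase cc 2 x) ^ n := map_pow φL (chartBase cc 2 x) n
  have e5 : φL (chartBase cc 2 t ^ (n + 2) * chartBase cc 2 x ^ n) =
      φL (chartBase cc 2 t ^ (n + 2)) * φL (chartBase cc 2 x ^ n) :=
    map_mul φL (chartBase cc 2 t ^ (n + 2)) (chartBase cc 2 x ^ n)
  have e6 : φL (chartBase cc 2 t ^ (n + 2)) = φL (chartBase cc 2 t) ^ (n + 2) := map_pow φL (chartBase cc 2 t) (n + 2)
  rw [← Ideal.map_map, map_K_two, Ideal.map_mul, CuspMember.map_span_singleton, map_sup₃, e1, e2, e3, e4, e5, e6, e4]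

end Local


end DepthPhaseC

end Summit.ResolutionOfSingularities.ResolutionOfSingularities.Theorems

end
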